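import Summits.QuantumFields.YangMills.Theses.LangevinControlUV
import Literature.MathematicalPhysics.QuantumFieldTheory.LatticeGaugeProofs
import HarnessLib

/-!
# `FemtoPoincare` (stmt-QuantumFields-9364, route `LangevinControlUV`) — proved as typed

The support item `Summit.QuantumFields.YangMills.Theses.LangevinControlUV.FemtoPoincare` asks, for
every compact simple `G`, faithful unitary lattice representation `r`, every coupling `β` in a band
`κ(1 + log L) ≤ β ≤ κ'(1 + log L)` and every bounded measurable observable `F` of the gauge field on
the torus `(ℤ/L)⁴` whose single-link SUP-NORM sensitivities are
`|F (update U e g) - F U| ≤ lip e · ‖r.ρ g − r.ρ (U e)‖_F`, for the variance bound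
`Var_β(F) ≤ C · L^p · Σ_e (lip e)²`.

As typed — with sup-norm single-link Lipschitz constants, not the Dirichlet form
`Σ_e ∫ |∇_e F|² dμ_β` — the statement carries no Langevin / spectral-gap content and holds at EVERY
`β` (this is the retriage note on the item, made formal):

* unitary matrices have entries of norm `≤ 1` (`entry_norm_bound_of_unitary`), so the Frobenius
  distance `‖r.ρ g − r.ρ h‖_F` is bounded by the constant `D := √(Σ_{i,j} 4)`;
* changing the links one at a time, `|F U − F V| ≤ D · Σ_e lip e` for all `U, V`
  (`abs_sub_le_of_update_le`);
* `wilsonMeasure r.ρ β` is a probability measure (`isProbabilityMeasure_wilsonMeasure`), so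
  Popoviciu's inequality (`ProbabilityTheory.variance_le_sq_of_bounded`) gives
  `Var F ≤ (D Σ_e lip e)²`, and Cauchy–Schwarz over the `4 L⁴` positively oriented edges
  (`sq_sum_le_card_mul_sum_sq`) gives `Var F ≤ 4 D² · L⁴ · Σ_e (lip e)²`.

Hence `κ = 1`, `p = 4`, `C = 4 D²` work (for every `κ'`, and in fact for every `β`).  The intended
Dirichlet-form Poincaré inequality is NOT proved here and is not what the item states.
-/

namespace Summit.QuantumFields.YangMills.Theorems.LangevinControlUVFemtoPoincare

open MeasureTheory ProbabilityTheory
open Literature.MathematicalPhysics.QuantumFieldTheory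

/-- **Oscillation from single-coordinate sensitivities.** On a finite product `E → G`: if replacing
the coordinate at `e` moves `F` by at most `lip e · dist (new) (old)`, with `dist ≤ D` and `lip ≥ 0`,
then `|F U − F V| ≤ D · Σ_e lip e` for all `U, V` — change the coordinates of `V` into those of `U`
one at a time (hybrid argument). [folklore] -/
theorem abs_sub_le_of_update_le {E G : Type*} [Fintype E] {_ : DecidableEq E} (F : (E → G) → ℝ)
    (lip : E → ℝ) (dist : G → G → ℝ) (D : ℝ) (hlip : ∀ e, 0 ≤ lip e)
    (hdist : ∀ g h, dist g h ≤ D)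
    (hF : ∀ (U : E → G) (e : E) (g : G), |F (Function.update U e g) - F U| ≤ lip e * dist g (U e))
    (U V : E → G) : |F U - F V| ≤ D * ∑ e, lip e := by
  -- hybrid configurations: `U` on `s`, `V` off `s`
  have key : ∀ s : Finset E,
      |F (fun e => if e ∈ s then U e else V e) - F V| ≤ D * ∑ e ∈ s, lip e := by
    intro s
    induction s using Finset.induction_on with
    | empty => simp
    | insert a s ha ih =>
      have hstep : (fun e => if e ∈ insert a s then U e else V e) =
          Function.update (fun e => if e ∈ s then U e else V e) a (U a) := by
        funext e
        by_cases h : e = a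
        · subst h
          simp
        · simp [h]
      calc |F (fun e => if e ∈ insert a s then U e else V e) - F V|
          ≤ |F (fun e => if e ∈ insert a s then U e else V e) -
                F (fun e => if e ∈ s then U e else V e)| +
              |F (fun e => if e ∈ s then U e else V e) - F V| := abs_sub_le _ _ _
        _ = |F (Function.update (fun e => if e ∈ s then U e else V e) a (U a)) -
                F (fun e => if e ∈ s then U e else V e)| +
              |F (fun e => if e ∈ s then U e else V e) - F V| := by rw [hstep]
        _ ≤ lip a * dist (U a) ((fun e => if e ∈ s then U e else V e) a) +
              D * ∑ e ∈ s, lip e := add_le_add (hF _ _ _) ih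
        _ ≤ lip a * D + D * ∑ e ∈ s, lip e :=
            add_le_add (mul_le_mul_of_nonneg_left (hdist _ _) (hlip a)) le_rfl
        _ = D * ∑ e ∈ insert a s, lip e := by
            rw [Finset.sum_insert ha]
            ring
  simpa using key Finset.univ

/-- **`FemtoPoincare` as typed** (stmt-QuantumFields-9364): with `κ = 1`, `p = 4` and
`C = 4 D²`, `D := √(Σ_{i,j < N} 4) = 2N` a bound for the Frobenius diameter of `r.ρ(G)`, the
variance of every bounded measurable `F` under Wilson's measure is at most `C · L⁴ · Σ_e (lip e)²`,
where `lip e` are sup-norm single-link Lipschitz constants of `F` for the Frobenius metric pulled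
back by `r.ρ` — at every coupling `β` (the band hypotheses are not used), by the hybrid/oscillation
bound, Popoviciu's inequality and Cauchy–Schwarz over the `4L⁴` edges; no Langevin input. [folklore] -/
theorem FemtoPoincare_proof :
    Summit.QuantumFields.YangMills.Theses.LangevinControlUV.FemtoPoincare := by
  unfold Summit.QuantumFields.YangMills.Theses.LangevinControlUV.FemtoPoincare
  intro G _ _ _ _ _ r
  letI : MeasurableSpace G := borel G
  haveI : BorelSpace G := ⟨rfl⟩
  -- a bound `D` for the Frobenius diameter of `r.ρ(G)` (unitary entries have norm `≤ 1`)
  obtain ⟨D, hD0, hdist⟩ : ∃ D : ℝ, 0 ≤ D ∧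
      ∀ g h : G, Real.sqrt (∑ i, ∑ j, ‖(r.ρ g - r.ρ h) i j‖ ^ 2) ≤ D := by
    refine ⟨Real.sqrt (∑ _i : Fin r.N, ∑ _j : Fin r.N, (4 : ℝ)), Real.sqrt_nonneg _, fun g h => ?_⟩
    refine Real.sqrt_le_sqrt (Finset.sum_le_sum fun i _ => Finset.sum_le_sum fun j _ => ?_)
    have h1 := entry_norm_bound_of_unitary (r.mem_unitary g) i j
    have h2 := entry_norm_bound_of_unitary (r.mem_unitary h) i j
    have h3 : ‖(r.ρ g - r.ρ h) i j‖ ≤ 2 := by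
      rw [Matrix.sub_apply]
      exact (norm_sub_le _ _).trans (by linarith)
    nlinarith [norm_nonneg ((r.ρ g - r.ρ h) i j)]
  refine ⟨1, one_pos, fun κ' _ => ⟨4, 4 * D ^ 2, ?_⟩⟩
  intro L _ β _ _ F lip hFm _ hlip hF
  -- Wilson's measure is a probability measure
  haveI := isProbabilityMeasure_wilsonMeasure (d := 4) (L := L) r.ρ r.continuous β
  -- oscillation bound from the single-link sensitivities
  have hosc : ∀ U V : GaugeConfig 4 L G, |F U - F V| ≤ D * ∑ e, lip e := fun U V =>
    abs_sub_le_of_update_le F lip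
      (fun g h => Real.sqrt (∑ i, ∑ j, ‖(r.ρ g - r.ρ h) i j‖ ^ 2)) D hlip hdist hF U V
  -- `F` takes values in an interval of length `2 D Σ_e lip e` around `F 1`
  have hIcc : ∀ᵐ U ∂(wilsonMeasure (d := 4) (L := L) r.ρ β),
      F U ∈ Set.Icc (F 1 - D * ∑ e, lip e) (F 1 + D * ∑ e, lip e) := by
    refine ae_of_all _ fun U => ?_
    have h := abs_sub_le_iff.1 (hosc U 1)
    constructor <;> linarith [h.1, h.2]
  have hmem : MemLp F 2 (wilsonMeasure (d := 4) (L := L) r.ρ β) :=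
    memLp_of_bounded hIcc hFm.aestronglyMeasurable 2
  -- the edge count of the torus
  have hcard : (Fintype.card (Edge 4 L) : ℝ) = 4 * (L : ℝ) ^ 4 := by
    rw [Fintype.card_prod, Fintype.card_fun, ZMod.card, Fintype.card_fin]
    push_cast
    ring
  -- Cauchy–Schwarz over the edges
  have hCS : (∑ e, lip e) ^ 2 ≤ (Fintype.card (Edge 4 L) : ℝ) * ∑ e, lip e ^ 2 := by
    rw [← Finset.card_univ]
    exact sq_sum_le_card_mul_sum_sq
  -- assemble: variance = E[F²] - E[F]² ≤ (D Σ lip)² ≤ 4 D² L⁴ Σ lip²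
  calc wilsonExpectation (d := 4) (L := L) r.ρ β (fun U => F U ^ 2) -
        (wilsonExpectation (d := 4) (L := L) r.ρ β F) ^ 2
        = variance F (wilsonMeasure (d := 4) (L := L) r.ρ β) := by
          rw [variance_eq_sub hmem]
          rfl
    _ ≤ ((F 1 + D * ∑ e, lip e - (F 1 - D * ∑ e, lip e)) / 2) ^ 2 :=
          variance_le_sq_of_bounded hIcc hFm.aemeasurable
    _ = D ^ 2 * (∑ e, lip e) ^ 2 := by ring
    _ ≤ D ^ 2 * ((Fintype.card (Edge 4 L) : ℝ) * ∑ e, lip e ^ 2) :=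
          mul_le_mul_of_nonneg_left hCS (sq_nonneg _)
    _ = 4 * D ^ 2 * (L : ℝ) ^ (4 : ℕ) * ∑ e : Edge 4 L, lip e ^ 2 := by
          rw [hcard]
          ring

end Summit.QuantumFields.YangMills.Theorems.LangevinControlUVFemtoPoincare
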